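import Mathlib.Analysis.InnerProductSpace.PiL2
import Mathlib.LinearAlgebra.AffineSpace.FiniteDimensional
import Mathlib.RingTheory.MvPolynomial.Basic
import Mathlib.Data.Set.Finite.Basic
import HarnessLib

/-!
# Finiteness of spatial central configurations of five bodies (Hampton–Jensen 2011)

Topic `Literature/Dynamics/NBody`. NAMED FACTS only (D-0014), no proofs: Theorem 1 of
[HamptonJensen2011] (Celest. Mech. Dyn. Astron. 109 (2011) 321–332), typed for the `pub-smale6`
cell, plus the explicit exceptional polynomials of its Table 1 (p. 326).

* Equation (2), p. 322: a central configuration of the `n`-body problem satisfies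
  `λ (x_j − c) = Σ_{i ≠ j} m_i (x_i − x_j) / r_{ij}³`, `1 ≤ j ≤ n`, with `λ < 0` and `c` the center
  of mass. "Spatial" (p. 322 l. 12–13, "the dimension of our configurations is `n − 2`", i.e. `3`
  for `n = 5`; Dziobek configurations, Moeckel 2001): the five points span `ℝ³`.
* Theorem 1, p. 322, verbatim: "There are finitely many central configurations of the Newtonian
  spatial five-body problem with the possible exception of some mass parameter values on which an
  explicitly given set of polynomials vanish (see Table 1 in Sect. 4)."
* Table 1, p. 326 ("Representatives of exceptional cases … All polynomials listed for a given cone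
  must be satisfied"): ray `[59]`: `m₁m₂ − m₃m₄ − m₃m₅`; `[72]`: `4m₁m₂ − (m₃+m₄)² − (m₃+m₅)² + m₃²
  − 2m₄m₅`; `[59,72]`: `m₃ − m₄ − m₅` and `m₄² + 2m₄m₅ + m₅² − m₂m₁`; six cones (`[210]`, `[453]`,
  `[210,275]`, `[193,210]`, `[210,453]`, `[268,453]`): `m₁ − m₄` and `m₂ − m₃`; ray `[270]`: "See
  Sect. 5" (a system (8)–(11) in `r₁₂, r₁₃` and the masses; the eliminant is "rather large and
  unwieldy", p. 328, NOT printed); ray `[275]`: "See Sect. 6" (`P₁ = 0` or `P₂ = 0`, degree-12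
  polynomials in `M_i = m_i³`, NOT printed; Lemma 1 p. 329, proved with interval arithmetic,
  reduces `P₁ = 0` for positive masses to a printed relation together with `m₁ = m₂` or `m₃ = m₄`).
  The whole exceptional set is invariant under renumbering the bodies (the table lists
  representatives up to the symmetry of the equations, p. 326 l. 4–5).

Encoding. Positions are `Fin 5 → EuclideanSpace ℝ (Fin 3)` (Euclidean `dist`). Central
configurations are counted up to isometry, exactly as in the paper, whose unknowns are the ten
mutual distances `r_{ij}` (`(ℂ*)^{10}`, p. 322 §2): the finiteness statement is that the set of
mutual-distance vectors realised by spatial central configurations with the given masses is finite.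
Because the paper does not print the `[270]` and `[275]` polynomials, Theorem 1 is typed with the
exceptional set existential — "a finite family of finite lists of rational polynomials, one list per
cone, all of whose members must vanish" — which is literally the shape of Table 1; the nine printed
rows are given as separate definitions (`hj11Row59`, …) so that a certificate can refer to them by
name. Nothing here asserts that the printed rows exhaust the exceptional set (they do not: rows
`[270]`, `[275]`).

Deliberately NOT here: the tropical-prevariety data (f-vector `(1, 576, 1620, 1420, 450)`, p. 326),
the 47 equations of §3, Lemma 1 (interval arithmetic), Moeckel's generic Dziobek finiteness.
-/

namespace Literature.Dynamics.NBody

open MvPolynomial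

/-- Newton's right-hand side for body `j` in equation (2) of [HamptonJensen2011] p. 322:
`Σ_{i ≠ j} m_i (x_i − x_j) / r_{ij}³` (positions in Euclidean `ℝ³`).
[cite: HamptonJensen2011, eq. (2) p. 322] -/
noncomputable def newtonForce3 (m : Fin 5 → ℝ) (x : Fin 5 → EuclideanSpace ℝ (Fin 3)) (j : Fin 5) :
    EuclideanSpace ℝ (Fin 3) :=
  ∑ i ∈ Finset.univ.erase j, (m i / dist (x i) (x j) ^ 3) • (x i - x j)

/-- Center of mass `c = (Σ m_i x_i) / (Σ m_i)` of a configuration.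
[cite: HamptonJensen2011, eq. (2) p. 322] -/
noncomputable def centerOfMass3 (m : Fin 5 → ℝ) (x : Fin 5 → EuclideanSpace ℝ (Fin 3)) :
    EuclideanSpace ℝ (Fin 3) :=
  (∑ i, m i)⁻¹ • ∑ i, m i • x i

/-- A **spatial central configuration** of the five-body problem with masses `m`
([HamptonJensen2011] eq. (2) p. 322 and the standing hypothesis "the dimension of our
configurations is `n − 2`", i.e. the five points span `ℝ³`): pairwise distinct positions `x`
with `λ (x_j − c) = Σ_{i≠j} m_i (x_i − x_j)/r_{ij}³` for some `λ < 0`, and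
`vectorSpan ℝ (range x)` of dimension `3`. [cite: HamptonJensen2011, eq. (2) p. 322] -/
def IsSpatialCC (m : Fin 5 → ℝ) (x : Fin 5 → EuclideanSpace ℝ (Fin 3)) : Prop :=
  (∀ i j : Fin 5, i ≠ j → x i ≠ x j) ∧
  (∃ lam : ℝ, lam < 0 ∧ ∀ j, lam • (x j - centerOfMass3 m x) = newtonForce3 m x j) ∧
  Module.finrank ℝ (vectorSpan ℝ (Set.range x)) = 3

/-- The mutual-distance vector `(r_{ij})_{i,j}` of a configuration (the paper's unknowns, §2–3).
[cite: HamptonJensen2011, §3 p. 324] -/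
noncomputable def mutualDistances (x : Fin 5 → EuclideanSpace ℝ (Fin 3)) : Fin 5 → Fin 5 → ℝ :=
  fun i j => dist (x i) (x j)

/-- Spatial central configurations with masses `m`, up to isometry: the set of realised
mutual-distance vectors. [cite: HamptonJensen2011, §2 p. 322] -/
def spatialCCDistanceVectors (m : Fin 5 → ℝ) : Set (Fin 5 → Fin 5 → ℝ) :=
  {r | ∃ x, IsSpatialCC m x ∧ r = mutualDistances x}

/-- The exceptional set cut out by a Table-1-shaped list of cones: a finite family of finite lists
of rational polynomials, "all polynomials listed for a given cone must be satisfied"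
([HamptonJensen2011] p. 326), closed under renumbering the bodies (the table lists representatives
up to symmetry). [cite: HamptonJensen2011, Table 1 p. 326] -/
def tableExceptionalSet (rows : Finset (Finset (MvPolynomial (Fin 5) ℚ))) : Set (Fin 5 → ℝ) :=
  {m | ∃ σ : Equiv.Perm (Fin 5), ∃ row ∈ rows, ∀ f ∈ row, aeval (m ∘ σ) f = 0}

/-- **Theorem 1** of [HamptonJensen2011] p. 322, verbatim: "There are finitely many central
configurations of the Newtonian spatial five-body problem with the possible exception of some mass
parameter values on which an explicitly given set of polynomials vanish (see Table 1 in Sect. 4)."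
Typed with the Table-1-shaped exceptional set existential (rows `[270]` and `[275]` are not
printed in closed form; the printed rows are `hj11Row59` … `hj11RowEqualPairs` below). Every row
must contain a NONZERO polynomial (`∀ row ∈ rows, ∃ f ∈ row, f ≠ 0`): without this clause the
family `{∅}` would put every mass vector into the exceptional set and the statement would be
vacuously true (referee audit 2026-08-18); a nonzero polynomial cannot vanish on the open positive
orthant, so each row cuts out a proper algebraic subset, as in the paper's Table 1.
[cite: HamptonJensen2011, Theorem 1 p. 322] -/
def hamptonJensen2011_theorem1_spatialFiveBodies : Prop :=
  ∃ rows : Finset (Finset (MvPolynomial (Fin 5) ℚ)),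
    (∀ row ∈ rows, ∃ f ∈ row, f ≠ 0) ∧
    ∀ m : Fin 5 → ℝ, (∀ k, 0 < m k) → m ∉ tableExceptionalSet rows →
      (spatialCCDistanceVectors m).Finite

/-! ### The printed rows of Table 1 (p. 326), bodies `1..5` ↦ indices `0..4`. -/

/-- Table 1, ray `[59]`: `m₁m₂ − m₃m₄ − m₃m₅`. [cite: HamptonJensen2011, Table 1 p. 326] -/
noncomputable def hj11Row59 : MvPolynomial (Fin 5) ℚ :=
  X 0 * X 1 - X 2 * X 3 - X 2 * X 4

/-- Table 1, ray `[72]`: `4m₁m₂ − (m₃+m₄)² − (m₃+m₅)² + m₃² − 2m₄m₅`.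
[cite: HamptonJensen2011, Table 1 p. 326] -/
noncomputable def hj11Row72 : MvPolynomial (Fin 5) ℚ :=
  4 * X 0 * X 1 - (X 2 + X 3) ^ 2 - (X 2 + X 4) ^ 2 + X 2 ^ 2 - 2 * X 3 * X 4

/-- Table 1, cone `[59,72]`: the two polynomials `m₃ − m₄ − m₅` and `m₄² + 2m₄m₅ + m₅² − m₂m₁`
(both must vanish). [cite: HamptonJensen2011, Table 1 p. 326] -/
noncomputable def hj11Row59_72 : Finset (MvPolynomial (Fin 5) ℚ) :=
  {X 2 - X 3 - X 4, X 3 ^ 2 + 2 * X 3 * X 4 + X 4 ^ 2 - X 1 * X 0}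

/-- Table 1, cones `[210]`, `[453]`, `[210,275]`, `[193,210]`, `[210,453]`, `[268,453]`: the two
polynomials `m₁ − m₄` and `m₂ − m₃` (both must vanish; p. 326: for real masses the polynomial `Q`
appearing in those saturated ideals vanishes iff `m₁ = m₄` and `m₂ = m₃`).
[cite: HamptonJensen2011, Table 1 p. 326] -/
noncomputable def hj11RowEqualPairs : Finset (MvPolynomial (Fin 5) ℚ) :=
  {X 0 - X 3, X 1 - X 2}

/-- The nine printed rows of Table 1 as a `tableExceptionalSet` family (rays `[270]`, `[275]`
excluded — not printed in closed form). [cite: HamptonJensen2011, Table 1 p. 326] -/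
noncomputable def hj11PrintedRows : Finset (Finset (MvPolynomial (Fin 5) ℚ)) :=
  {{hj11Row59}, {hj11Row72}, hj11Row59_72, hj11RowEqualPairs}

/-- Each printed row of Table 1 contains a nonzero polynomial (evaluate at `(1,1,0,0,0)`, resp.
`(1,0,0,0,0)`), so `hj11PrintedRows` satisfies the non-vacuity clause of
`hamptonJensen2011_theorem1_spatialFiveBodies`. [folklore] -/
theorem hj11PrintedRows_nonvacuous : ∀ row ∈ hj11PrintedRows, ∃ f ∈ row, f ≠ 0 := by
  have h59 : hj11Row59 ≠ 0 := by
    intro h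
    have := congrArg (aeval (![1, 1, 0, 0, 0] : Fin 5 → ℚ)) h
    simp [hj11Row59] at this
  have h72 : hj11Row72 ≠ 0 := by
    intro h
    have := congrArg (aeval (![1, 1, 0, 0, 0] : Fin 5 → ℚ)) h
    simp [hj11Row72] at this
  have h5972 : (X 2 - X 3 - X 4 : MvPolynomial (Fin 5) ℚ) ≠ 0 := by
    intro h
    have := congrArg (aeval (![0, 0, 1, 0, 0] : Fin 5 → ℚ)) h
    simp at this
  have hEq : (X 0 - X 3 : MvPolynomial (Fin 5) ℚ) ≠ 0 := by
    intro h
    have := congrArg (aeval (![1, 0, 0, 0, 0] : Fin 5 → ℚ)) h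
    simp at this
  intro row hrow
  simp only [hj11PrintedRows, Finset.mem_insert, Finset.mem_singleton] at hrow
  rcases hrow with rfl | rfl | rfl | rfl
  · exact ⟨hj11Row59, by simp, h59⟩
  · exact ⟨hj11Row72, by simp, h72⟩
  · exact ⟨X 2 - X 3 - X 4, by simp [hj11Row59_72], h5972⟩
  · exact ⟨X 0 - X 3, by simp [hj11RowEqualPairs], hEq⟩

end Literature.Dynamics.NBody
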